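import Summits.Ventures.HSemireg.WedgeHankelRecurrenceGaussTuranDeterminant

/-!
# Venture HSemireg — **THE WALL–WETZEL CHAIN-SEQUENCE CRITERION (finite form)**: for a positive recurrence `q_0 = 1`, `q_1 = X − a_0`, `q_{n+2} = (X − a_{n+1}) q_{n+1} − b_{n+1} q_n`,
# ALL ZEROS OF `q_{t+1}` LIE BELOW `B` ⇔ `q_k(B) > 0` for every `k ≤ t + 1` ⇔ `a_n < B` (`n ≤ t`) and `b_n ∕ ((B − a_{n−1})(B − a_n))` (`1 ≤ n ≤ t`) IS A CHAIN SEQUENCE: `= (1 − g_{n−1}) g_n` with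
# `g_0 = 0`, `0 < g_n < 1`; the COMPARISON form (`b_n ≤ (1 − g_{n−1}) g_n (B − a_{n−1})(B − a_n)` with any parameters `0 ≤ g_n < 1` suffices, and then `q_{n+1}(B) ≥ (B − a_n)(1 − g_n) q_n(B) > 0`);
# WALL'S constant chain sequence `1∕4 = (1 − ½)·½` gives the uniform STRICT bound: `a_n ≤ B − 2c`, `b_n ≤ c²` ⇒ all zeros `< B`; the mirror statements for a lower bound `A` by reflection

HONEST FRAMING. Part of the Lean index of the computation cell `pub-hsemireg` (seat p10 gen 46, Sunday typer «UNIFORM-IN-n»).  Real polynomials and finite sums only; no variety, no cohomology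
theory, no sheaf, no Ext group and no semiregularity map is constructed here; nothing here says that HC / HC_CM / HC_AV holds; no Literature fact (unproved `Prop`) is declared or used.  Custodian
versions as in `WedgeHankelSiegelIdeal` (1/3).
SOURCES (cited).  H. S. Wall, M. Wetzel, *Quadratic forms and convergence regions for continued fractions*, Duke Math. J. 11 (1944) 89–102; H. S. Wall, *Analytic Theory of Continued Fractions*
(1948) Ch. IV–V (chain sequences); T. S. Chihara, *An Introduction to Orthogonal Polynomials* (1978), Ch. III §5 (chain sequences, the comparison test Thm 5.7) and Ch. IV §2, Thm 2.1–2.2 (the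
true interval of orthogonality: the zeros of all `P_n` lie left of `η` iff `λ_{n+1}∕((c_n − η)(c_{n+1} − η))` is a chain sequence); M. E. H. Ismail, *Classical and Quantum Orthogonal Polynomials in
One Variable* (2005), Thm 7.2.1–7.2.3.
PROOF TYPED HERE.  (i) `q_k(B) > 0 ∀ k ≤ n` kills every sign change in Szegő's Sturm count N294 at `ξ = B` ⇒ no zero `≥ B`; conversely zeros of `q_{t+1}` below `B` ⇒ zeros of every `q_{m+1}`,
`m ≤ t`, below `B` (interlacing N279) ⇒ `q_m(B), q_{m+1}(B) > 0` (N337).  (ii) Comparison: the invariant `0 < q_n(B)`, `(B − a_n)(1 − g_n) q_n(B) ≤ q_{n+1}(B)` propagates through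
`q_{n+2}(B) = (B − a_{n+1}) q_{n+1}(B) − b_{n+1} q_n(B)` using `b_{n+1} q_n(B) ≤ (1 − g_n)(B − a_n) q_n(B) · g_{n+1}(B − a_{n+1}) ≤ q_{n+1}(B) g_{n+1}(B − a_{n+1})`.  (iii) Converse: with
`u_n = q_n(B) > 0`, `g_n := 1 − u_{n+1}∕((B − a_n) u_n)` has `g_0 = 0`, `0 < g_n < 1` and `(1 − g_{n−1}) g_n (B − a_{n−1})(B − a_n) = ((B − a_n) u_n − u_{n+1})∕u_{n−1} = b_n`.  (iv) Reflection
`q ↦ (−1)^n q_n(−X)` (N325 `recurrence_reflect_spec`) for the lower end point.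
DEDUP DISCLOSURE (`rg -n -i 'chain sequence|wall.wetzel|wallWetzel|zeros_lt_of_chain' Summits/Ventures/HSemireg Literature`, 2026-09-03): chain sequences are only CITED (N306 header); N329
`zeros_le_gershgorin` gives the non-strict `x ≤ max (a_i + c_i + c_{i+1})`, N345 ∕ N306 use the Sturm count at `ξ = 0` for one direction only.  The 10 names below: 0 hits tree-wide.

WHAT IS IN THE TREE.  N294 `sturm_count_recurrence`; N279 `recurrence_zeros_interlace`; N337 `recurrence_eval_signs_outside`; N325 `recurrence_reflect_spec`; N306
`recurrence_zeros_neg_of_forall_eval_zero_pos` (the case `B = 0`).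
THIS FILE (namespace `Summit.Ventures.HSemireg.Wedge.HankelOuter` continued; CHAINED on N371 (import only); 0 definitions):
* §1137 `recurrence_zeros_lt_of_forall_eval_pos`, `recurrence_roots_lt_of_succ`, **`recurrence_forall_eval_pos_iff`** (`q_k(B) > 0 ∀ k ≤ t+1` ⇔ zeros of `q_{t+1}` `< B`),
  `recurrence_forall_eval_alt_iff` (mirror: `(−1)^k q_k(A) > 0 ∀ k` ⇔ zeros `> A`), **`wallWetzel_eval_pos_of_chain`** (comparison invariant), **`zeros_lt_of_chain`**, **`chain_of_zeros_lt`**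
  (WALL–WETZEL, both directions), `zeros_lt_of_wall_quarter` (`a_n ≤ B − 2c`, `b_n ≤ c²` ⇒ zeros `< B`), `zeros_gt_of_chain`, `zeros_gt_of_wall_quarter` (mirrors).
CAVEATS.  Finite sections (`n ≤ t`) only: the infinite chain-sequence theory (maximal ∕ minimal parameters, Wall's continued-fraction characterisation) is not typed.  Nothing Ext-side.  New names only.
-/

open Module Polynomial
open scoped Matrix Polynomial

namespace Summit.Ventures.HSemireg.Wedge.HankelOuter

/-! ## §1137. Chain sequences and the true interval of orthogonality (finite form) -/

/-- **`q_k(B) > 0` for all `k ≤ n` ⇒ every zero of `q_n` is `< B`** (Sturm count at `ξ = B`). [Szegő Thm 3.3.4; Chihara IV Thm 2.1; this file, §1137] -/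
theorem recurrence_zeros_lt_of_forall_eval_pos {q : ℕ → ℝ[X]} {a b : ℕ → ℝ} (hq0 : q 0 = 1) (hq1 : q 1 = Polynomial.X - C (a 0))
    (hrec : ∀ n, q (n + 2) = (Polynomial.X - C (a (n + 1))) * q (n + 1) - C (b (n + 1)) * q n) (hb : ∀ j, 0 < b j) {n : ℕ} {z : Fin n → ℝ}
    (hz : StrictMono z) (hzq : q n = ∏ i, (Polynomial.X - C (z i))) {B : ℝ} (hpos : ∀ k, k ≤ n → 0 < (q k).eval B) (i : Fin n) : z i < B := by
  have hcount := sturm_count_recurrence hq0 hq1 hrec hb n hz hzq (ξ := B) (fun k hk => (hpos k hk).ne')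
  have hempty : ((Finset.range n).filter (fun k => (q k).eval B * (q (k + 1)).eval B < 0)).card = 0 := by
    rw [Finset.card_eq_zero, Finset.filter_eq_empty_iff]
    intro k hk
    have hk' := Finset.mem_range.1 hk
    exact not_lt.2 (mul_pos (hpos k hk'.le) (hpos (k + 1) hk')).le
  rw [hempty, eq_comm, Finset.card_eq_zero, Finset.filter_eq_empty_iff] at hcount
  have hle : z i ≤ B := not_lt.1 (hcount (Finset.mem_univ i))
  refine lt_of_le_of_ne hle fun h0 => ?_
  have hroot : (q n).eval (z i) = 0 := by
    rw [hzq, eval_prod]; exact Finset.prod_eq_zero (Finset.mem_univ i) (by simp)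
  rw [h0] at hroot
  exact (hpos n le_rfl).ne' hroot

/-- **Zeros of `q_{m+2}` below `B` ⇒ zeros of `q_{m+1}` below `B`** (interlacing). [this file, §1137] -/
theorem recurrence_roots_lt_of_succ {q : ℕ → ℝ[X]} {a b : ℕ → ℝ} (hq0 : q 0 = 1) (hq1 : q 1 = Polynomial.X - C (a 0))
    (hrec : ∀ n, q (n + 2) = (Polynomial.X - C (a (n + 1))) * q (n + 1) - C (b (n + 1)) * q n) (hb : ∀ j, 0 < b j) (m : ℕ) {B : ℝ}
    (h : ∀ s, (q (m + 2)).eval s = 0 → s < B) : ∀ s, (q (m + 1)).eval s = 0 → s < B := by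
  obtain ⟨z, y, -, -, hzq, hyq, hint⟩ := recurrence_zeros_interlace hq0 hq1 hrec hb m
  intro s hs
  rw [hzq, eval_prod, Finset.prod_eq_zero_iff] at hs
  obtain ⟨k, -, hk⟩ := hs
  rw [eval_sub, eval_X, eval_C, sub_eq_zero] at hk
  have hyroot : (q (m + 2)).eval (y k.succ) = 0 := by
    rw [hyq, eval_prod]; exact Finset.prod_eq_zero (Finset.mem_univ k.succ) (by simp)
  rw [hk]
  exact (hint k).2.trans (h _ hyroot)

/-- **`q_k(B) > 0` for every `k ≤ t + 1` ⇔ all zeros of `q_{t+1}` lie below `B`.** [Chihara IV Thm 2.1; Szegő Thm 3.3.4; this file, §1137] -/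
theorem recurrence_forall_eval_pos_iff {q : ℕ → ℝ[X]} {a b : ℕ → ℝ} (hq0 : q 0 = 1) (hq1 : q 1 = Polynomial.X - C (a 0))
    (hrec : ∀ n, q (n + 2) = (Polynomial.X - C (a (n + 1))) * q (n + 1) - C (b (n + 1)) * q n) (hb : ∀ j, 0 < b j) (t : ℕ) (B : ℝ) :
    (∀ k, k ≤ t + 1 → 0 < (q k).eval B) ↔ ∀ s, (q (t + 1)).eval s = 0 → s < B := by
  constructor
  · intro hpos s hs
    obtain ⟨z, -, hz, -, hzq, -, -⟩ := recurrence_zeros_interlace hq0 hq1 hrec hb t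
    rw [hzq, eval_prod, Finset.prod_eq_zero_iff] at hs
    obtain ⟨i, -, hi⟩ := hs
    rw [eval_sub, eval_X, eval_C, sub_eq_zero] at hi
    rw [hi]
    exact recurrence_zeros_lt_of_forall_eval_pos hq0 hq1 hrec hb hz hzq hpos i
  · intro h
    have hdown : ∀ d m, m + d = t → ∀ s, (q (m + 1)).eval s = 0 → s < B := by
      intro d
      induction d with
      | zero => intro m hm; rw [add_zero] at hm; subst hm; exact h
      | succ d ih => intro m hm; exact recurrence_roots_lt_of_succ hq0 hq1 hrec hb m (ih (m + 1) (by omega))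
    intro k hk
    rcases k with _ | m
    · rw [hq0, eval_one]; exact one_pos
    · exact ((recurrence_eval_signs_outside hq0 hq1 hrec hb m B).1 (hdown (t - m) m (by omega))).2

/-- **Mirror: `(−1)^k q_k(A) > 0` for every `k ≤ t + 1` ⇔ all zeros of `q_{t+1}` lie above `A`** (reflection `q_n ↦ (−1)^n q_n(−X)`, recurrence `(−a, b)`). [this file, §1137] -/
theorem recurrence_forall_eval_alt_iff {q : ℕ → ℝ[X]} {a b : ℕ → ℝ} (hq0 : q 0 = 1) (hq1 : q 1 = Polynomial.X - C (a 0))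
    (hrec : ∀ n, q (n + 2) = (Polynomial.X - C (a (n + 1))) * q (n + 1) - C (b (n + 1)) * q n) (hb : ∀ j, 0 < b j) (t : ℕ) (A : ℝ) :
    (∀ k, k ≤ t + 1 → 0 < (-1 : ℝ) ^ k * (q k).eval A) ↔ ∀ s, (q (t + 1)).eval s = 0 → A < s := by
  obtain ⟨h0', h1', hrec', -⟩ := recurrence_reflect_spec hq0 hq1 hrec
  have key := recurrence_forall_eval_pos_iff (q := fun n => C ((-1 : ℝ) ^ n) * (q n).comp (C (-1 : ℝ)⁻¹ * Polynomial.X)) (a := fun n => -a n) (b := b) h0' h1' hrec' hb t (-A)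
  have hev : ∀ n s, (C ((-1 : ℝ) ^ n) * (q n).comp (C (-1 : ℝ)⁻¹ * Polynomial.X)).eval (-s) = (-1 : ℝ) ^ n * (q n).eval s := fun n s => by
    rw [eval_mul, eval_C, eval_comp, eval_mul, eval_C, eval_X, show (-1 : ℝ)⁻¹ * -s = s by norm_num]
  simp only [hev] at key
  rw [key]
  constructor
  · intro h s hs
    have h1 : (C ((-1 : ℝ) ^ (t + 1)) * (q (t + 1)).comp (C (-1 : ℝ)⁻¹ * Polynomial.X)).eval (-s) = 0 := by rw [hev, hs, mul_zero]
    have := h (-s) h1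
    linarith
  · intro h s hs
    have hne : (-1 : ℝ) ^ (t + 1) ≠ 0 := pow_ne_zero _ (by norm_num)
    have h1 := hev (t + 1) (-s)
    rw [neg_neg, hs] at h1
    have := h (-s) ((mul_eq_zero.1 h1.symm).resolve_left hne)
    linarith

/-- **THE COMPARISON INVARIANT (Wall–Wetzel ⇐, quantitative)**: if `a_n < B`, `0 ≤ g_n < 1` (`n ≤ t`) and `b_{n+1} ≤ (1 − g_n) g_{n+1} (B − a_n)(B − a_{n+1})` (`n + 1 ≤ t`), then for every
`n ≤ t`: `q_n(B) > 0` and `(B − a_n)(1 − g_n) q_n(B) ≤ q_{n+1}(B)`. [Wall–Wetzel 1944; Chihara III Thm 5.7, IV Thm 2.1; this file, §1137] -/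
theorem wallWetzel_eval_pos_of_chain {q : ℕ → ℝ[X]} {a b : ℕ → ℝ} (hq0 : q 0 = 1) (hq1 : q 1 = Polynomial.X - C (a 0))
    (hrec : ∀ n, q (n + 2) = (Polynomial.X - C (a (n + 1))) * q (n + 1) - C (b (n + 1)) * q n) {t : ℕ} {B : ℝ} {g : ℕ → ℝ}
    (ha : ∀ n, n ≤ t → a n < B) (hg : ∀ n, n ≤ t → 0 ≤ g n ∧ g n < 1) (hbn : ∀ n, n + 1 ≤ t → b (n + 1) ≤ (1 - g n) * g (n + 1) * ((B - a n) * (B - a (n + 1)))) :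
    ∀ n, n ≤ t → 0 < (q n).eval B ∧ (B - a n) * (1 - g n) * (q n).eval B ≤ (q (n + 1)).eval B := by
  intro n
  induction n with
  | zero =>
    intro _
    refine ⟨by rw [hq0, eval_one]; exact one_pos, ?_⟩
    rw [hq0, hq1, eval_one, eval_sub, eval_X, eval_C, mul_one]
    nlinarith [ha 0 (Nat.zero_le _), (hg 0 (Nat.zero_le _)).1]
  | succ n ih =>
    intro hn
    obtain ⟨hu, huv⟩ := ih (by omega)
    have han := ha n (by omega)
    have hgn := hg n (by omega)
    have han1 := ha (n + 1) hn
    have hgn1 := hg (n + 1) hn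
    have hv : 0 < (q (n + 1)).eval B := lt_of_lt_of_le (mul_pos (mul_pos (sub_pos.2 han) (sub_pos.2 hgn.2)) hu) huv
    refine ⟨hv, ?_⟩
    rw [show n + 1 + 1 = n + 2 from rfl, hrec n, eval_sub, eval_mul, eval_mul, eval_sub, eval_X, eval_C, eval_C]
    have h1 := mul_le_mul_of_nonneg_right huv (mul_nonneg hgn1.1 (sub_pos.2 han1).le)
    have h2 := mul_le_mul_of_nonneg_right (hbn n hn) hu.le
    linarith [h1, h2]

/-- **WALL–WETZEL (⇐): a chain-sequence comparison puts all zeros of `q_{t+1}` below `B`.** [Wall–Wetzel 1944; Chihara IV Thm 2.1; this file, §1137] -/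
theorem zeros_lt_of_chain {q : ℕ → ℝ[X]} {a b : ℕ → ℝ} (hq0 : q 0 = 1) (hq1 : q 1 = Polynomial.X - C (a 0))
    (hrec : ∀ n, q (n + 2) = (Polynomial.X - C (a (n + 1))) * q (n + 1) - C (b (n + 1)) * q n) (hb : ∀ j, 0 < b j) {t : ℕ} {B : ℝ} {g : ℕ → ℝ}
    (ha : ∀ n, n ≤ t → a n < B) (hg : ∀ n, n ≤ t → 0 ≤ g n ∧ g n < 1) (hbn : ∀ n, n + 1 ≤ t → b (n + 1) ≤ (1 - g n) * g (n + 1) * ((B - a n) * (B - a (n + 1)))) :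
    ∀ s, (q (t + 1)).eval s = 0 → s < B := by
  refine (recurrence_forall_eval_pos_iff hq0 hq1 hrec hb t B).1 fun k hk => ?_
  rcases k with _ | n
  · rw [hq0, eval_one]; exact one_pos
  · obtain ⟨hu, huv⟩ := wallWetzel_eval_pos_of_chain hq0 hq1 hrec ha hg hbn n (by omega)
    exact lt_of_lt_of_le (mul_pos (mul_pos (sub_pos.2 (ha n (by omega))) (sub_pos.2 (hg n (by omega)).2)) hu) huv

/-- **WALL–WETZEL (⇒): if all zeros of `q_{t+1}` lie below `B` then `a_n < B` (`n ≤ t`) and `b_n = (1 − g_{n−1}) g_n (B − a_{n−1})(B − a_n)` (`1 ≤ n ≤ t`) with the explicit parameters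
`g_n = 1 − q_{n+1}(B)∕((B − a_n) q_n(B))`, `g_0 = 0`, `0 < g_n < 1`.** [Wall–Wetzel 1944; Chihara IV Thm 2.1–2.2; this file, §1137] -/
theorem chain_of_zeros_lt {q : ℕ → ℝ[X]} {a b : ℕ → ℝ} (hq0 : q 0 = 1) (hq1 : q 1 = Polynomial.X - C (a 0))
    (hrec : ∀ n, q (n + 2) = (Polynomial.X - C (a (n + 1))) * q (n + 1) - C (b (n + 1)) * q n) (hb : ∀ j, 0 < b j) {t : ℕ} {B : ℝ}
    (h : ∀ s, (q (t + 1)).eval s = 0 → s < B) :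
    (∀ n, n ≤ t → a n < B) ∧ ∃ g : ℕ → ℝ, g 0 = 0 ∧ (∀ n, n + 1 ≤ t → 0 < g (n + 1) ∧ g (n + 1) < 1) ∧
      ∀ n, n + 1 ≤ t → b (n + 1) = (1 - g n) * g (n + 1) * ((B - a n) * (B - a (n + 1))) := by
  have hpos := (recurrence_forall_eval_pos_iff hq0 hq1 hrec hb t B).2 h
  have haB : ∀ n, n ≤ t → a n < B := by
    intro n hn
    rcases n with _ | m
    · have h1 := hpos 1 (by omega)
      rw [hq1, eval_sub, eval_X, eval_C] at h1
      linarith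
    · have h2 := hpos (m + 2) (by omega)
      have h1 := hpos (m + 1) (by omega)
      have h0 := hpos m (by omega)
      rw [hrec m, eval_sub, eval_mul, eval_mul, eval_sub, eval_X, eval_C, eval_C] at h2
      have hb0 : 0 < b (m + 1) * (q m).eval B := mul_pos (hb _) h0
      by_contra hle
      rw [not_lt] at hle
      nlinarith
  refine ⟨haB, fun n => 1 - (q (n + 1)).eval B / ((B - a n) * (q n).eval B), ?_, ?_, ?_⟩
  · show 1 - (q (0 + 1)).eval B / ((B - a 0) * (q 0).eval B) = 0
    rw [zero_add, hq1, hq0, eval_one, mul_one, eval_sub, eval_X, eval_C, div_self (sub_ne_zero.2 (haB 0 (Nat.zero_le _)).ne'), sub_self]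
  · intro n hn
    have hu := hpos (n + 1) (by omega)
    have hv := hpos (n + 2) (by omega)
    have h0 := hpos n (by omega)
    have ha1 := sub_pos.2 (haB (n + 1) hn)
    have hden : 0 < (B - a (n + 1)) * (q (n + 1)).eval B := mul_pos ha1 hu
    constructor
    · show 0 < 1 - (q (n + 1 + 1)).eval B / ((B - a (n + 1)) * (q (n + 1)).eval B)
      rw [sub_pos, div_lt_one hden, show n + 1 + 1 = n + 2 from rfl, hrec n, eval_sub, eval_mul, eval_mul, eval_sub, eval_X, eval_C, eval_C]
      nlinarith [mul_pos (hb (n + 1)) h0]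
    · show 1 - (q (n + 1 + 1)).eval B / ((B - a (n + 1)) * (q (n + 1)).eval B) < 1
      rw [sub_lt_self_iff]
      exact div_pos hv hden
  · intro n hn
    have hu := hpos (n + 1) (by omega)
    have h0 := hpos n (by omega)
    have ha0 := sub_pos.2 (haB n (by omega))
    have ha1 := sub_pos.2 (haB (n + 1) hn)
    show b (n + 1) = (1 - (1 - (q (n + 1)).eval B / ((B - a n) * (q n).eval B))) * (1 - (q (n + 1 + 1)).eval B / ((B - a (n + 1)) * (q (n + 1)).eval B)) *
      ((B - a n) * (B - a (n + 1)))
    rw [show n + 1 + 1 = n + 2 from rfl, hrec n, eval_sub, eval_mul, eval_mul, eval_sub, eval_X, eval_C, eval_C]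
    field_simp
    ring

/-- **WALL'S CONSTANT CHAIN SEQUENCE `1∕4`: `a_n ≤ B − 2c` (`n ≤ t`) and `b_n ≤ c²` (`1 ≤ n ≤ t`), `c > 0` ⇒ every zero of `q_{t+1}` is `< B`** — a STRICT, `t`-uniform upper bound (e.g. `B = sup a + 2 √(sup b)`).
[Wall 1948; Chihara IV Thm 2.3 ∕ Ex. 2.4; this file, §1137] -/
theorem zeros_lt_of_wall_quarter {q : ℕ → ℝ[X]} {a b : ℕ → ℝ} (hq0 : q 0 = 1) (hq1 : q 1 = Polynomial.X - C (a 0))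
    (hrec : ∀ n, q (n + 2) = (Polynomial.X - C (a (n + 1))) * q (n + 1) - C (b (n + 1)) * q n) (hb : ∀ j, 0 < b j) {t : ℕ} {B c : ℝ} (hc : 0 < c)
    (ha : ∀ n, n ≤ t → a n + 2 * c ≤ B) (hbc : ∀ n, n + 1 ≤ t → b (n + 1) ≤ c ^ 2) : ∀ s, (q (t + 1)).eval s = 0 → s < B := by
  refine zeros_lt_of_chain hq0 hq1 hrec hb (g := fun _ => 1 / 2) (fun n hn => by linarith [ha n hn]) (fun n _ => by norm_num) fun n hn => ?_
  have h1 : 2 * c ≤ B - a n := by linarith [ha n (by omega)]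
  have h2 : 2 * c ≤ B - a (n + 1) := by linarith [ha (n + 1) hn]
  have h3 := mul_le_mul h1 h2 (by positivity) (by linarith)
  nlinarith [hbc n hn]

/-- **Mirror (⇐): a chain-sequence comparison at a lower end point `A` (`A < a_n`, `b_{n+1} ≤ (1 − g_n) g_{n+1} (a_n − A)(a_{n+1} − A)`) puts all zeros of `q_{t+1}` above `A`.** [Chihara IV
Thm 2.1; this file, §1137] -/
theorem zeros_gt_of_chain {q : ℕ → ℝ[X]} {a b : ℕ → ℝ} (hq0 : q 0 = 1) (hq1 : q 1 = Polynomial.X - C (a 0))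
    (hrec : ∀ n, q (n + 2) = (Polynomial.X - C (a (n + 1))) * q (n + 1) - C (b (n + 1)) * q n) (hb : ∀ j, 0 < b j) {t : ℕ} {A : ℝ} {g : ℕ → ℝ}
    (ha : ∀ n, n ≤ t → A < a n) (hg : ∀ n, n ≤ t → 0 ≤ g n ∧ g n < 1) (hbn : ∀ n, n + 1 ≤ t → b (n + 1) ≤ (1 - g n) * g (n + 1) * ((a n - A) * (a (n + 1) - A))) :
    ∀ s, (q (t + 1)).eval s = 0 → A < s := by
  obtain ⟨h0', h1', hrec', -⟩ := recurrence_reflect_spec hq0 hq1 hrec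
  have key := zeros_lt_of_chain (q := fun n => C ((-1 : ℝ) ^ n) * (q n).comp (C (-1 : ℝ)⁻¹ * Polynomial.X)) (a := fun n => -a n) (b := b) h0' h1' hrec' hb (B := -A) (g := g)
    (fun n hn => by linarith [ha n hn]) hg fun n hn => by
      have e : (-A - -a n) * (-A - -a (n + 1)) = (a n - A) * (a (n + 1) - A) := by ring
      rw [e]; exact hbn n hn
  intro s hs
  have hs' : (C ((-1 : ℝ) ^ (t + 1)) * (q (t + 1)).comp (C (-1 : ℝ)⁻¹ * Polynomial.X)).eval (-s) = 0 := by
    rw [eval_mul, eval_C, eval_comp, eval_mul, eval_C, eval_X, show (-1 : ℝ)⁻¹ * -s = s by norm_num, hs, mul_zero]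
  have := key (-s) hs'
  linarith

/-- **Mirror of Wall's bound: `A + 2c ≤ a_n`, `b_n ≤ c²`, `c > 0` ⇒ every zero of `q_{t+1}` is `> A`.** [this file, §1137] -/
theorem zeros_gt_of_wall_quarter {q : ℕ → ℝ[X]} {a b : ℕ → ℝ} (hq0 : q 0 = 1) (hq1 : q 1 = Polynomial.X - C (a 0))
    (hrec : ∀ n, q (n + 2) = (Polynomial.X - C (a (n + 1))) * q (n + 1) - C (b (n + 1)) * q n) (hb : ∀ j, 0 < b j) {t : ℕ} {A c : ℝ} (hc : 0 < c)
    (ha : ∀ n, n ≤ t → A + 2 * c ≤ a n) (hbc : ∀ n, n + 1 ≤ t → b (n + 1) ≤ c ^ 2) : ∀ s, (q (t + 1)).eval s = 0 → A < s := by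
  refine zeros_gt_of_chain hq0 hq1 hrec hb (g := fun _ => 1 / 2) (fun n hn => by linarith [ha n hn]) (fun n _ => by norm_num) fun n hn => ?_
  have h1 : 2 * c ≤ a n - A := by linarith [ha n (by omega)]
  have h2 : 2 * c ≤ a (n + 1) - A := by linarith [ha (n + 1) hn]
  have h3 := mul_le_mul h1 h2 (by positivity) (by linarith)
  nlinarith [hbc n hn]

end Summit.Ventures.HSemireg.Wedge.HankelOuter
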